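import Summits.NavierStokesRegularity.NavierStokesRegularity.Theses.AxisymmetricExtremality
import Summits.NavierStokesRegularity.NavierStokesRegularity.Theorems.AxisymmetricExtremalityPFoldToAxisymmetric
import Summits.NavierStokesRegularity.NavierStokesRegularity.Theorems.AxisymmetricExtremalityClayDatumCritical
import Summits.NavierStokesRegularity.NavierStokesRegularity.Theorems.AxisymmetricExtremalityAxisymmetricKatoGlobalNoSwirlStratum
import Summits.NavierStokesRegularity.NavierStokesRegularity.Theorems.AxisymmetricExtremalityAxisymmetricKatoGlobalReduction
import Summits.NavierStokesRegularity.NavierStokesRegularity.Theorems.AxisymmetricExtremalityAxisymmetricKatoGlobalStubSereginLogSwirlOrigin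
import Literature.Analysis.FluidPDE.AxisymmetricReflection
import HarnessLib

/-!
# Strategist s16-g3 (independent census, family `s`) — typed companion for the crux
`AxisymmetricExtremality.AxisymmetricKatoGlobal` (stmt-NavierStokesRegularity-15453)

Kernel-checked bookkeeping behind `STRATEGY-CENSUS-s16.md` (gen 3).  Nothing here is new
mathematics: every theorem is a short composition of LANDED tree theorems, recorded so that the
census claims "weaker intermediate suffices", "the O(2) instance is a theorem", "the a-priori
half of the best split is the crux again" are machine-checked rather than asserted.

§ A  WEAKER INTERMEDIATE FROM THE SUMMIT SIDE.  `closes` consumes only the THRESHOLD INSTANCE of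
     the crux: `NoAxisymMinimalBlowupDatum` (no axisymmetric Rusin–Šverák minimal blow-up datum).
     `summit_of_noAxisymMinimalBlowupDatum : MinimalDatumPFold → NoAxisymMinimalBlowupDatum →
     NavierStokesRegularity` (with the PROVED sibling crux `PFoldToAxisymmetric`), and
     `noAxisymMinimalBlowupDatum_of_AKG` (the crux implies it).
§ B  THE O(2) INSTANCE IS A THEOREM.  If the Smith step produces DIHEDRAL (`D_p = ⟨R_{2π/p}, σ⟩`,
     `σ` = meridian reflection `reflY`) minimal data instead of cyclic ones — same topological
     input for `p = 2^k` (finite 2-groups) — the compactness upgrade yields an `O(2)`-equivariant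
     minimal datum, which is axisymmetric WITHOUT swirl (`IsAxisymmetric.hasNoSwirl_of_reflY_eq`)
     and therefore has a global Kato solution by the LANDED no-swirl stratum
     (`axisymmetricKatoGlobal_noSwirl_stratum`): `summit_of_dihedral : MinimalDatumDihedral →
     DihedralToO2 → NavierStokesRegularity` — the crux AKG is not needed on this branch.
§ C  BEST TYPED SPLIT OF THE CRUX ITSELF ("criterion ∧ a-priori estimate").  The criterion half is
     a THEOREM of the tree (`AKG_of_swirlAxisModulus`: Seregin 2022 §2, discharged, + the landed
     capstone); the a-priori half `SwirlAxisModulus` is therefore ≥ the crux — no strictly smaller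
     piece remains.
§ D  SCHWARTZ-CLASS REDUCTION (Dec-C).  `AxisymSchwartzKatoGlobal` (the crux on Clay data only) and
     the bridge `CriticalClassUpgrade`; `AKG_of_schwartzSplit` (modus ponens) and the converse
     direction `axisymSchwartzKatoGlobal_of_AKG` (landed `ClayDatumCritical`).  The hard half is
     the classical axisymmetric-with-swirl problem (ns.S25) in Kato form.
§ E  STRENGTHENING `HolderSwirlAxisModulus` (a-priori Hölder modulus of `Γ` at the axis, the
     Chen–Fang–Zhang 2017 level): typed signature; it implies `SwirlAxisModulus` (elementary,
     `holder_le_log`), hence the crux — and is an a-priori estimate with no known source.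
-/

set_option linter.dupNamespace false
set_option linter.unusedVariables false

noncomputable section

open Set MeasureTheory Filter Topology Function
open scoped ENNReal NNReal
open Literature.Analysis.FluidPDE Literature.Analysis.FunctionSpaces
open Summit.NavierStokesRegularity.NavierStokesRegularity.Theses.AxisymmetricExtremality
open Summit.NavierStokesRegularity.NavierStokesRegularity.Theorems

namespace Summit.NavierStokesRegularity.NavierStokesRegularity.Cruxes.AxisymmetricKatoGlobal.StrategistS16g3

local notation "ℝ³" => EuclideanSpace ℝ (Fin 3)
local notation "ℂ³" => EuclideanSpace ℂ (Fin 3)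

/-! ## § 0  The Clay-failure antecedent shared by the route's Smith-type cruxes -/

/-- "Clay (A) fails at viscosity `ν`": verbatim the antecedent of `MinimalDatumPFold`. -/
def ClayFailsAt (ν : ℝ) : Prop :=
  ∃ v₀ : ℝ³ → ℝ³, ContDiff ℝ (⊤ : ℕ∞) v₀ ∧ NSWave0.IsDivFree v₀ ∧ HasRapidSpatialDecay v₀ ∧
    ¬ ∃ (u : ℝ → ℝ³ → ℝ³) (p : ℝ → ℝ³ → ℝ), IsSmoothOnHalfSpace u ∧ IsSmoothOnHalfSpace p ∧
      IsNavierStokesSolution ν 0 v₀ u p ∧ HasBoundedEnergy u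

/-! ## § A  Weaker intermediate: the threshold instance -/

/-- THRESHOLD INSTANCE of the crux (what `closes` actually consumes): no Rusin–Šverák minimal
blow-up datum is axisymmetric about the `x 2`-axis. -/
def NoAxisymMinimalBlowupDatum : Prop :=
  ∀ ν : ℝ, 0 < ν → ∀ (u₀ : ℝ³ → ℝ³) (g : HomSobolev ℝ³ ℂ³ (1 / 2 : ℝ)),
    IsMinimalBlowupDatum ν u₀ g → IsAxisymmetric u₀ → False

/-- The crux implies its threshold instance. -/
theorem noAxisymMinimalBlowupDatum_of_AKG :
    AxisymmetricKatoGlobal → NoAxisymMinimalBlowupDatum := by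
  intro h ν hν u₀ g hmin hax
  obtain ⟨hL3, hrep, hdiv, -, hnot⟩ := hmin
  exact hnot (h ν hν u₀ g hL3 hrep hdiv (fun θ x => hax θ x))

/-- The threshold instance SUFFICES for the route: `closes` with `AxisymmetricKatoGlobal`
replaced by `NoAxisymMinimalBlowupDatum` (and the proved sibling crux `PFoldToAxisymmetric`
supplied by its landed proof). -/
theorem summit_of_noAxisymMinimalBlowupDatum
    (h₂ : MinimalDatumPFold) (hT : NoAxisymMinimalBlowupDatum) : NavierStokesRegularity := by
  show Literature.NS.NavierStokesExistenceSmoothR3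
  intro ν hν u₀ hsm hdiv hdec
  by_contra hno
  obtain ⟨u₁, g, hmin, hax⟩ :=
    axisymmetricExtremality_pFoldToAxisymmetric_proof ν hν (h₂ ν hν ⟨u₀, hsm, hdiv, hdec, hno⟩)
  exact hT ν hν u₁ g hmin (fun θ x => hax θ x)

/-! ## § B  The O(2) (dihedral) instance is a theorem: AKG is dispensable on that branch -/

/-- DIHEDRAL minimal data from Clay failure: for unboundedly many `p ≥ 2` a minimal blow-up
datum equivariant under the rotation `R_{2π/p}` about the `x 2`-axis AND under the meridian
reflection `σ (x₀,x₁,x₂) = (x₀,−x₁,x₂)` (`reflY`), i.e. under the dihedral group `D_p ⊂ O(3)`.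
Smith theory gives this from the SAME input as the cyclic version whenever `p = 2^k`
(finite 2-groups acting on an `𝔽₂`-acyclic compact space have fixed points). -/
def MinimalDatumDihedral : Prop :=
  ∀ ν : ℝ, 0 < ν → ClayFailsAt ν → ∀ N : ℕ, ∃ p : ℕ, N ≤ p ∧ 2 ≤ p ∧
    ∃ (u₀ : ℝ³ → ℝ³) (g : HomSobolev ℝ³ ℂ³ (1 / 2 : ℝ)), IsMinimalBlowupDatum ν u₀ g ∧
      (∀ x, u₀ (rotZ (2 * Real.pi / p) x) = rotZ (2 * Real.pi / p) (u₀ x)) ∧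
      (∀ x, u₀ (reflY x) = reflY (u₀ x))

/-- COMPACTNESS UPGRADE with the reflection carried along: dihedral minimal data for
unboundedly many `p` ⇒ an `O(2)`-equivariant minimal datum (axisymmetric and `σ`-equivariant).
Provable exactly like the landed `PFoldToAxisymmetric` (closedness of `σ`-equivariance under
the modulated `L³` limit; the axis-pinning step is unchanged). -/
def DihedralToO2 : Prop :=
  ∀ ν : ℝ, 0 < ν →
    (∀ N : ℕ, ∃ p : ℕ, N ≤ p ∧ 2 ≤ p ∧
      ∃ (u₀ : ℝ³ → ℝ³) (g : HomSobolev ℝ³ ℂ³ (1 / 2 : ℝ)), IsMinimalBlowupDatum ν u₀ g ∧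
        (∀ x, u₀ (rotZ (2 * Real.pi / p) x) = rotZ (2 * Real.pi / p) (u₀ x)) ∧
        (∀ x, u₀ (reflY x) = reflY (u₀ x))) →
    ∃ (u₀ : ℝ³ → ℝ³) (g : HomSobolev ℝ³ ℂ³ (1 / 2 : ℝ)), IsMinimalBlowupDatum ν u₀ g ∧
      IsAxisymmetric u₀ ∧ (∀ x, u₀ (reflY x) = reflY (u₀ x))

/-- No `O(2)`-equivariant minimal blow-up datum exists — a THEOREM: such a datum is axisymmetric
without swirl, hence has a global Kato solution by the landed no-swirl stratum. -/
theorem no_O2_minimalBlowupDatum {ν : ℝ} (hν : 0 < ν) {u₀ : ℝ³ → ℝ³}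
    {g : HomSobolev ℝ³ ℂ³ (1 / 2 : ℝ)} (hmin : IsMinimalBlowupDatum ν u₀ g)
    (hax : IsAxisymmetric u₀) (hσ : ∀ x, u₀ (reflY x) = reflY (u₀ x)) : False := by
  obtain ⟨hL3, -, hdiv, -, hnot⟩ := hmin
  have hsw : HasNoSwirl u₀ := hax.hasNoSwirl_of_reflY_eq hσ
  exact hnot (AxisymmetricKatoGlobal.NoSwirlStratum.axisymmetricKatoGlobal_noSwirl_stratum ν hν u₀
    hL3 hdiv (fun θ x => hax θ x) hsw)

/-- **AKG is dispensable on the dihedral branch**: the summit from the two Smith-side items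
alone. -/
theorem summit_of_dihedral (hD : MinimalDatumDihedral) (hU : DihedralToO2) :
    NavierStokesRegularity := by
  show Literature.NS.NavierStokesExistenceSmoothR3
  intro ν hν u₀ hsm hdiv hdec
  by_contra hno
  obtain ⟨u₁, g, hmin, hax, hσ⟩ := hU ν hν (hD ν hν ⟨u₀, hsm, hdiv, hdec, hno⟩)
  exact no_O2_minimalBlowupDatum hν hmin hax hσ

/-- Sanity: dihedral data are in particular cyclic data, so `MinimalDatumDihedral` implies the
route's `MinimalDatumPFold` (the strengthening is only the extra reflection). -/
theorem minimalDatumPFold_of_dihedral (hD : MinimalDatumDihedral) : MinimalDatumPFold := by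
  intro ν hν hfail N
  obtain ⟨p, hNp, h2p, u₀, g, hmin, hrot, -⟩ := hD ν hν hfail N
  exact ⟨p, hNp, h2p, u₀, g, hmin, fun x => hrot x⟩

/-! ## § C  Criterion ∧ a-priori estimate: the criterion half is a theorem -/

/-- The a-priori half: verbatim the registered stub `stub_swirlAxisModulus` (logarithmic modulus
of the swirl `Γ = r u_θ` at the axis, uniformly up to the final time of an axisymmetric Kato
solution). -/
def SwirlAxisModulus : Prop :=
  ∀ ν : ℝ, 0 < ν → ∀ T : ℝ, 0 < T → ∀ (u₀ : ℝ³ → ℝ³) (g : HomSobolev ℝ³ ℂ³ (1 / 2 : ℝ))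
    (u : ℝ → ℝ³ → ℝ³), g.Represents (Literature.Analysis.FunctionSpaces.EuclideanSpace.complexify ∘ u₀) →
    IsKatoSolutionOn T ν u₀ u → ContDiffOn ℝ (⊤ : ℕ∞) (uncurry u) (Ioo 0 T ×ˢ univ) →
    (∀ t ∈ Ioo 0 T, IsAxisymmetric (u t)) → ∀ t₀ ∈ Ioo 0 T, ∃ C δ₀ : ℝ, 0 < δ₀ ∧ δ₀ < 1 ∧
      ∀ t ∈ Ico t₀ T, ∀ x : ℝ³, cylRadius x ≤ δ₀ → |swirl (u t) x| ≤ C / |Real.log (cylRadius x)| ^ 3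

/-- The CRITERION half is discharged: the a-priori modulus alone gives the crux
(landed capstone + discharged Seregin-2022 fact).  Hence `SwirlAxisModulus` is ≥ the crux. -/
theorem AKG_of_swirlAxisModulus (h : SwirlAxisModulus) : AxisymmetricKatoGlobal :=
  AxisymmetricKatoGlobal.Registered.AxisymmetricKatoGlobal_of_logSwirlFacts
    AxisymmetricKatoGlobal.EulerScaling.seregin2022_logSwirl_regularAtOrigin_holds h

/-! ## § D  Schwartz-class reduction -/

/-- The crux restricted to CLAY DATA (smooth, divergence-free, rapidly decaying, axisymmetric):
Kato form of the classical axisymmetric-with-swirl problem ns.S25. -/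
def AxisymSchwartzKatoGlobal : Prop :=
  ∀ ν : ℝ, 0 < ν → ∀ u₀ : ℝ³ → ℝ³, ContDiff ℝ (⊤ : ℕ∞) u₀ → NSWave0.IsDivFree u₀ →
    HasRapidSpatialDecay u₀ → IsAxisymmetric u₀ → HasGlobalKatoSolution ν u₀

/-- The bridge: Schwartz-class axisymmetric regularity ⇒ critical-class axisymmetric regularity
(a Tao-2013-type localisation/concentration statement inside the axisymmetric class; NOT in
print for `Ḣ^{1/2}` data — Tao arXiv:1108.1165 Thm 1.20 covers the `H¹`/Schwartz/energy
categories only). -/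
def CriticalClassUpgrade : Prop := AxisymSchwartzKatoGlobal → AxisymmetricKatoGlobal

/-- Assembly of the Schwartz split (modus ponens — `trivial_seam`). -/
theorem AKG_of_schwartzSplit (h₁ : AxisymSchwartzKatoGlobal) (h₂ : CriticalClassUpgrade) :
    AxisymmetricKatoGlobal := h₂ h₁

/-- Converse bookkeeping: the crux implies its Schwartz-class restriction (landed
`ClayDatumCritical`: a Clay datum is an `L³`, weakly divergence-free, `Ḣ^{1/2}`-represented datum). -/
theorem axisymSchwartzKatoGlobal_of_AKG (h : AxisymmetricKatoGlobal) : AxisymSchwartzKatoGlobal := by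
  intro ν hν u₀ hsm hdiv hdec hax
  obtain ⟨hL3, hwdiv, g, hrep⟩ := axisymmetricExtremality_clayDatumCritical_proof u₀ hsm hdiv hdec
  exact h ν hν u₀ g hL3 hrep hwdiv (fun θ x => hax θ x)

/-! ## § E  Strengthening: Hölder modulus of the swirl at the axis -/

/-- S⁺: a-priori HÖLDER modulus of `Γ` at the axis up to the final time (the Chen–Fang–Zhang 2017
criterion level), same frame as `SwirlAxisModulus`. -/
def HolderSwirlAxisModulus : Prop :=
  ∀ ν : ℝ, 0 < ν → ∀ T : ℝ, 0 < T → ∀ (u₀ : ℝ³ → ℝ³) (g : HomSobolev ℝ³ ℂ³ (1 / 2 : ℝ))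
    (u : ℝ → ℝ³ → ℝ³), g.Represents (Literature.Analysis.FunctionSpaces.EuclideanSpace.complexify ∘ u₀) →
    IsKatoSolutionOn T ν u₀ u → ContDiffOn ℝ (⊤ : ℕ∞) (uncurry u) (Ioo 0 T ×ˢ univ) →
    (∀ t ∈ Ioo 0 T, IsAxisymmetric (u t)) → ∀ t₀ ∈ Ioo 0 T, ∃ C α δ₀ : ℝ, 0 < α ∧ 0 < δ₀ ∧ δ₀ < 1 ∧
      ∀ t ∈ Ico t₀ T, ∀ x : ℝ³, cylRadius x ≤ δ₀ → |swirl (u t) x| ≤ C * cylRadius x ^ α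

/-- Elementary: `r^α |log r|³ ≤ (3/α)³` for `0 < r ≤ 1`, `α > 0`. -/
theorem rpow_mul_abs_log_pow_three_le {r α : ℝ} (hr : 0 < r) (hr1 : r ≤ 1) (hα : 0 < α) :
    r ^ α * |Real.log r| ^ 3 ≤ (3 / α) ^ 3 := by
  have hα3 : 0 < α / 3 := by positivity
  have key := Real.abs_log_mul_self_rpow_lt r (α / 3) hr hr1 hα3
  -- `|log r * r^(α/3)| < 1/(α/3) = 3/α`
  have h1 : |Real.log r| * r ^ (α / 3) ≤ 3 / α := by
    have : |Real.log r * r ^ (α / 3)| = |Real.log r| * r ^ (α / 3) := by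
      rw [abs_mul, abs_of_pos (Real.rpow_pos_of_pos hr _)]
    rw [← this]
    have h3 : 1 / (α / 3) = 3 / α := by field_simp
    exact (le_of_lt key).trans (le_of_eq h3)
  have h0 : 0 ≤ |Real.log r| * r ^ (α / 3) := by positivity
  have h2 : (|Real.log r| * r ^ (α / 3)) ^ 3 ≤ (3 / α) ^ 3 :=
    pow_le_pow_left₀ h0 h1 3
  have h4 : (|Real.log r| * r ^ (α / 3)) ^ 3 = r ^ α * |Real.log r| ^ 3 := by
    rw [mul_pow, ← Real.rpow_natCast (r ^ (α / 3)) 3, ← Real.rpow_mul hr.le]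
    have : α / 3 * ((3 : ℕ) : ℝ) = α := by push_cast; ring
    rw [this, mul_comm]
  rw [h4] at h2
  exact h2

/-- S⁺ ⇒ the a-priori log-modulus (hence, by § C, the crux): a Hölder modulus is a log³ modulus. -/
theorem swirlAxisModulus_of_holder (h : HolderSwirlAxisModulus) : SwirlAxisModulus := by
  intro ν hν T hT u₀ g u hrep hK hsm hax t₀ ht₀
  obtain ⟨C, α, δ₀, hα, hδ₀, hδ₁, hmod⟩ := h ν hν T hT u₀ g u hrep hK hsm hax t₀ ht₀
  refine ⟨max C 0 * (3 / α) ^ 3, δ₀, hδ₀, hδ₁, fun t ht x hx => ?_⟩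
  have hb := hmod t ht x hx
  by_cases hr0 : cylRadius x = 0
  · -- on the axis the swirl vanishes
    have : swirl (u t) x = 0 := swirl_eq_zero_of_cylRadius_eq_zero (u t) hr0
    rw [this, abs_zero]
    positivity
  · have hrpos : 0 < cylRadius x := lt_of_le_of_ne (by unfold cylRadius; positivity) (Ne.symm hr0)
    have hr1 : cylRadius x ≤ 1 := hx.trans hδ₁.le
    have hrlt1 : cylRadius x < 1 := lt_of_le_of_lt hx hδ₁
    have hlogpos : 0 < |Real.log (cylRadius x)| := by
      rw [abs_pos]
      exact Real.log_ne_zero_of_pos_of_ne_one hrpos hrlt1.ne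
    have hl3 : 0 < |Real.log (cylRadius x)| ^ 3 := pow_pos hlogpos 3
    have hel := rpow_mul_abs_log_pow_three_le hrpos hr1 hα
    -- |Γ| ≤ C r^α ≤ max C 0 · r^α = max C 0 · (r^α |log r|³) / |log r|³ ≤ max C 0 (3/α)³ / |log r|³
    have step1 : |swirl (u t) x| ≤ max C 0 * cylRadius x ^ α :=
      hb.trans (mul_le_mul_of_nonneg_right (le_max_left C 0) (Real.rpow_nonneg hrpos.le α))
    have step2 : max C 0 * cylRadius x ^ α
        = max C 0 * (cylRadius x ^ α * |Real.log (cylRadius x)| ^ 3) / |Real.log (cylRadius x)| ^ 3 := by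
      field_simp
    rw [step2] at step1
    refine step1.trans ?_
    apply div_le_div_of_nonneg_right _ hl3.le
    exact mul_le_mul_of_nonneg_left hel (le_max_right C 0)

end Summit.NavierStokesRegularity.NavierStokesRegularity.Cruxes.AxisymmetricKatoGlobal.StrategistS16g3

end
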